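import Literature.Analysis.UnboundedOperators.HeatKernel
import HarnessLib

/-!
# The Fourier transform of the Gauss–Weierstrass kernel is the heat symbol (discharge)

Sibling proof file of `HeatKernel.lean` (D-0014: named facts `def X : Prop` are discharged as
`theorem X_holds : X`). It discharges

* `Literature.fourierIntegral_heatKernel_holds : fourierIntegral_heatKernel` — on a finite-dimensional
  real inner product space `E` (Borel σ-algebra, `volume`) and for every `0 < t`,
  `𝓕 (heatKernel t) ξ = heatSymbol t ξ = exp (-(2π)² t ‖ξ‖²)` for all `ξ : E`, in Mathlib's
  Fourier convention `𝓕 f ξ = ∫ exp (-2πi⟪x, ξ⟫) f x dx`, where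
  `heatKernel t x = (4πt)^{-n/2} exp (-‖x‖²/(4t))`, `n = finrank ℝ E`.

## Sources

* E. M. Stein, *Singular Integrals and Differentiability Properties of Functions*, Princeton
  (1970), Ch. III §2.1, identity (α) in the proof of Proposition 5 (the formula for the Poisson
  kernel): `∫_{ℝⁿ} e^{-πδ|x|²} e^{-2πi x·ξ} dx = δ^{-n/2} e^{-π|ξ|²/δ}` for `δ > 0` ("immediately
  reducible by a change of variables to the very well-known special case `δ = 1`"). With
  `δ = 1/(4πt)` this reads `𝓕 (e^{-|x|²/(4t)}) (ξ) = (4πt)^{n/2} e^{-4π²t|ξ|²}`; dividing by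
  `(4πt)^{n/2}` gives exactly the vendored statement `𝓕 (heatKernel t) = heatSymbol t`.

## Proof architecture (as formalised)

Mathlib proves Stein's (α) on a finite-dimensional real inner product space, for a complex
parameter, as `fourier_gaussian_innerProductSpace`:
`𝓕 (fun v => cexp (-b * ‖v‖²)) w = (π / b) ^ (n/2) * cexp (-π² ‖w‖² / b)` for `0 < re b`.

1. `x ↦ (heatKernel t x : ℂ)` is the scalar `(4πt)^{-n/2}` times `x ↦ cexp (-b‖x‖²)` with
   `b = 1/(4t)` (`Literature.Analysis.UnboundedOperators.heatKernel_eq` and casts); the scalar is pulled out of `𝓕`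
   (`VectorFourier.fourierIntegral_const_smul`; `𝓕` on `E → ℂ` unfolds to
   `VectorFourier.fourierIntegral 𝐞 volume (innerₗ E)` by `rfl`).
2. `fourier_gaussian_innerProductSpace` with `b = 1/(4t)`.
3. Bookkeeping of the constant: `π / b = 4πt`; `((4πt : ℝ) : ℂ) ^ ((n : ℂ)/2) = ↑((4πt)^{n/2})`
   (`Complex.ofReal_cpow`, `0 ≤ 4πt`); `(4πt)^{-n/2} (4πt)^{n/2} = 1` (`Real.rpow_neg`); and
   `-π²‖ξ‖²/b = -(2π)² t ‖ξ‖²`.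
-/

open MeasureTheory
open scoped Real FourierTransform

noncomputable section

namespace Literature.Analysis.UnboundedOperators

variable {E : Type*} [NormedAddCommGroup E] [InnerProductSpace ℝ E] [FiniteDimensional ℝ E]
  [MeasurableSpace E] [BorelSpace E]

/-- **Discharge of `fourierIntegral_heatKernel`.** `𝓕 (heatKernel t) ξ = exp (-(2π)² t ‖ξ‖²)`
for `0 < t` and all `ξ`, in Mathlib's Fourier convention `𝓕 f ξ = ∫ exp (-2πi⟪x, ξ⟫) f x dx`.
This is Stein's Gaussian identity (α), `∫ e^{-πδ|x|²} e^{-2πi x·ξ} dx = δ^{-n/2} e^{-π|ξ|²/δ}`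
(`δ > 0`), at `δ = 1/(4πt)`, divided by `(4πt)^{n/2}`; in Lean it is Mathlib's
`fourier_gaussian_innerProductSpace` with `b = 1/(4t)` followed by bookkeeping of the normalising
constant. Stein, *Singular Integrals*, Ch. III §2.1 (α).
[cite: SteinSingularIntegrals1970, Ch. III §2.1 (α)] -/
theorem fourierIntegral_heatKernel_holds : fourierIntegral_heatKernel (E := E) := by
  intro t ht ξ
  have hb : 0 < ((1 / (4 * t) : ℝ) : ℂ).re := by simp only [Complex.ofReal_re]; positivity
  have h4 : (0 : ℝ) < 4 * π * t := by positivity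
  -- the kernel is the constant `(4πt)^{-n/2}` times the Gaussian `cexp (-b‖x‖²)`, `b = 1/(4t)`
  have hK : (fun x : E => (heatKernel t x : ℂ)) =
      (((4 * π * t) ^ (-(Module.finrank ℝ E : ℝ) / 2) : ℝ) : ℂ) •
        fun x : E => Complex.exp (-((1 / (4 * t) : ℝ) : ℂ) * ‖x‖ ^ 2) := by
    funext x
    simp only [Pi.smul_apply, smul_eq_mul, heatKernel_eq, Complex.ofReal_mul, Complex.ofReal_exp]
    push_cast
    ring_nf
  have hF : 𝓕 ((((4 * π * t) ^ (-(Module.finrank ℝ E : ℝ) / 2) : ℝ) : ℂ) •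
        fun x : E => Complex.exp (-((1 / (4 * t) : ℝ) : ℂ) * ‖x‖ ^ 2)) =
      (((4 * π * t) ^ (-(Module.finrank ℝ E : ℝ) / 2) : ℝ) : ℂ) •
        𝓕 (fun x : E => Complex.exp (-((1 / (4 * t) : ℝ) : ℂ) * ‖x‖ ^ 2)) :=
    VectorFourier.fourierIntegral_const_smul _ _ _ _ _
  -- Stein's (α) / Mathlib's `fourier_gaussian_innerProductSpace`
  rw [hK, hF, Pi.smul_apply, fourier_gaussian_innerProductSpace hb ξ, smul_eq_mul]
  -- bookkeeping: `π / b = 4πt`, `(4πt)^{-n/2} (4πt)^{n/2} = 1`, `-π²‖ξ‖²/b = -(2π)² t ‖ξ‖²`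
  have h1 : (π : ℂ) / ((1 / (4 * t) : ℝ) : ℂ) = ((4 * π * t : ℝ) : ℂ) := by
    push_cast
    field_simp
  have h2 : ((4 * π * t : ℝ) : ℂ) ^ ((Module.finrank ℝ E : ℂ) / 2) =
      (((4 * π * t) ^ ((Module.finrank ℝ E : ℝ) / 2) : ℝ) : ℂ) := by
    rw [Complex.ofReal_cpow h4.le]
    push_cast
    rfl
  have h3 : Complex.exp (-(π : ℂ) ^ 2 * ((‖ξ‖ : ℝ) : ℂ) ^ 2 / ((1 / (4 * t) : ℝ) : ℂ)) =
      ((heatSymbol t ξ : ℝ) : ℂ) := by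
    rw [heatSymbol, Complex.ofReal_exp]
    congr 1
    push_cast
    field_simp
    ring
  rw [h1, h2, h3, ← mul_assoc, ← Complex.ofReal_mul, neg_div, Real.rpow_neg h4.le,
    inv_mul_cancel₀ (Real.rpow_pos_of_pos h4 _).ne', Complex.ofReal_one, one_mul]

end Literature.Analysis.UnboundedOperators
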